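import Summits.QuantumFields.YangMills.Theorems.LuscherReductionDressedRitzPolyakovLiftCouplingSymmetry
import Summits.QuantumFields.YangMills.Theorems.LuscherReductionDressedRitzPolyakovLiftStaticsDressedSymmetry
import Summits.QuantumFields.YangMills.Theorems.LuscherReductionRunningReductionKTPhysSpace
import HarnessLib

/-!
# Crux `DressedRitz` (stmt-QuantumFields-20205), line «polyakovlift» r5, stub S-LEAK `stub_liftLeakage` — support XIII:
# `S₃` symmetry bookkeeping for the in-level hypotheses (GR) ∕ (CW) ∕ (RL) of the closing press-buttons: doublets are EXACT, cross-type pairs are EXACT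

Support module (fleet seat ym-20205-polyakovlift-s1 gen 1; `--supports stmt-QuantumFields-20205`, helper, no closure claim).  The landed closing
press-buttons for the registered stub `…Cruxes.DressedRitz.PolyakovLift.stub_liftLeakage` (IX `LiftLeak.liftLeakage_dressed_of_referenceLaw`, p532178;
X `LiftLeak.residualLaw_allBases_of_reference_lift_width`, p533270) take, for the dressed REFERENCE lifts `v_n = dressedLiftVec β Ω G_n` (`G_n = ψ_n/Ω₁` the
one-site eigen-ratios at `B₁`), three inputs inside each exactly degenerate one-site level: (RL) a residual law per vector, (CW) a common (or `δ`-close)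
approximate eigenvalue, (GR) near-orthogonality `|⟨v_n,v_{n'}⟩| ≤ γ‖v_n‖‖v_{n'}‖`.  The disprover's located hazard for the `∀`-basis form of S-LEAK is
exactly the freedom to rotate inside such levels (cdisprove-20205-1 (T2)/(G1-b), `Negative/LeakageMixtureHazard`, `Negative/DoubletRotationVoid`).

This file transports the fine theory's `S₃` axis-permutation symmetry (infvol-p1's `…PolyakovLiftCouplingSymmetry.lean`: the two-time forms
`(f,h) ↦ ⟨K_β^a u_f, K_β^b u_h⟩` are invariant, symmetric, bilinear — `l2_iterIns_doublet`, `l2_iterIns_eq_zero_of_invariant ∕ _of_sign`; and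
`…StaticsDressedSymmetry.lean`: `l2_dressedLiftVec_eq_zero_of_invariant ∕ _of_sign`) to those three slots:

* §1 DOUBLETS (a pair `(G₁, G₂)` of physical one-site functions on which some axis permutation acts by a genuine rotation, `cs² + sn² = 1`, `sn ≠ 0` — e.g.
  ANY orthonormal basis of an `E`-doublet level of the one-site model divided by the invariant one-site vacuum): ★ `doublet_dressed_numbers` — the
  dressed Gram ∕ form ∕ two-step numbers of the two rows COINCIDE and the cross Gram entry VANISHES, exactly (every raw vacuum, `L`, `β`);
  `residual_expand`; ★ `doublet_residual_eq` — `‖(K_β − a)v₁‖² = ‖(K_β − a)v₂‖²` for every `a`; hence ★★ `doublet_residualLaw_iff` ((RL) for one row ⟺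
  (RL) for the other, SAME `a`, same `ρ` — so `a` is cluster-constant on a doublet: (CW) with `δ = 0`), `doublet_rayleigh_eq` (equal Rayleigh quotients),
  `doublet_gram_le` ((GR) with any `γ ≥ 0`).  Inside an `E`-doublet NO basis choice and NO estimate is needed beyond ONE row's residual law.
* §2 CROSS-TYPE pairs inside an accidentally degenerate level: `gram_le_of_invariant`, `gram_le_of_sign` — (GR) with any `γ ≥ 0` for an invariant
  (resp. sign-type) `G_n` against a `G_{n'}` of vanishing (resp. sign-twisted) `S₃`-average (re-keyed from infvol-p1's dressed symmetry zeros).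
* §3 `inLevelGram_of_zero_or_bound` — the (GR) input of IX∕X from a per-pair alternative «exact symmetry zero ∨ genuine bound».

So the OPEN content of (GR)∕(CW) is confined to ACCIDENTAL degeneracies of two one-site levels of the SAME one-dimensional `S₃`-type (or two doublets)
at `B₁ = 2/λ³` — the same residue infvol-p1 located for (o2) of S-STAT.  Nothing of the renormalisation-group estimate (RL) itself is proved.

HONEST FRAMING: exact symmetry bookkeeping at fixed lattice on the conditional femto rung R2b1; `stub_liftLeakage` stays OPEN; nothing here bears on
infinite volume, the continuum limit or the Clay gap.
References: M. Lüscher, NPB 219 (1983) 233, §2 (cubic group, symmetry sectors) [cite: Luscher1983, §2]; M. Lüscher, U. Wolff, NPB 339 (1990) 222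
[cite: LuscherWolff1990, §2]; T. Kato, J. Phys. Soc. Japan 4 (1949) 334 [cite: Kato1949, §1].
-/

set_option autoImplicit false

noncomputable section

open MeasureTheory Filter Topology Finset
open Literature.MathematicalPhysics.QuantumFieldTheory
open Literature.MathematicalPhysics.QuantumLattice
open scoped BigOperators

namespace Summit.QuantumFields.YangMills.Theorems.FemtoTransferGap.LiftLeak

open Summit.QuantumFields.YangMills.Theorems.FemtoTransferGap
open Summit.QuantumFields.YangMills.Theorems.FemtoTransferGap.PolyakovLift

variable {L : ℕ} [NeZero L]

/-! ## §1 Doublets: the dressed numbers of the two rows coincide, the cross entry vanishes, residual laws transfer -/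

/-- ★ **Dressed numbers of a rotating doublet.**  `φ` physical with `K_βφ = λ₀φ` (a raw vacuum); `(G₁, G₂)` physical one-site functions with
`G₁∘P_c = cs·G₁ + sn·G₂`, `G₂∘P_c = −sn·G₁ + cs·G₂` for some axis permutation `c`, `cs² + sn² = 1`, `sn ≠ 0`; `v_i = dressedLiftVec β φ G_i`.  Then
`⟨v₁,v₂⟩ = 0`, `‖v₁‖² = ‖v₂‖²`, `⟨v₁,K_βv₁⟩ = ⟨v₂,K_βv₂⟩`, `⟨v₁,K_βv₂⟩ = 0`, `‖K_βv₁‖² = ‖K_βv₂‖²` — EXACTLY (Schur `2 × 2` for the invariant two-time forms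
at separations `2m, 2m+1, 2m+2`, infvol-p1's `l2_iterIns_doublet`). [cite: Luscher1983, §2] -/
theorem doublet_dressed_numbers (β : ℝ) {φ : GaugeConfig 3 L SU2 → ℝ} (hφ : IsPhys φ)
    (heig : transferApply β φ = levelValue su2Rep L β 0 • φ) {G₁ G₂ : GaugeConfig 3 1 SU2 → ℝ} (hG₁ : IsPhys G₁) (hG₂ : IsPhys G₂)
    (c : Equiv.Perm (Fin 3)) {cs sn : ℝ} (hrot : cs ^ 2 + sn ^ 2 = 1) (hsn : sn ≠ 0)
    (h₁ : (fun V => G₁ (configPerm c V)) = fun V => cs * G₁ V + sn * G₂ V)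
    (h₂ : (fun V => G₂ (configPerm c V)) = fun V => -sn * G₁ V + cs * G₂ V) :
    l2 (dressedLiftVec β φ G₁) (dressedLiftVec β φ G₂) = 0 ∧
      l2 (dressedLiftVec β φ G₁) (dressedLiftVec β φ G₁) = l2 (dressedLiftVec β φ G₂) (dressedLiftVec β φ G₂) ∧
      l2 (dressedLiftVec β φ G₁) (transferApply β (dressedLiftVec β φ G₁)) = l2 (dressedLiftVec β φ G₂) (transferApply β (dressedLiftVec β φ G₂)) ∧
      l2 (dressedLiftVec β φ G₁) (transferApply β (dressedLiftVec β φ G₂)) = 0 ∧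
      l2 (transferApply β (dressedLiftVec β φ G₁)) (transferApply β (dressedLiftVec β φ G₁)) =
        l2 (transferApply β (dressedLiftVec β φ G₂)) (transferApply β (dressedLiftVec β φ G₂)) := by
  unfold dressedLiftVec liftVec
  set m := dressSteps L with hm
  set t := flowTime β L with ht
  obtain ⟨z00, e00⟩ := l2_iterIns_doublet β hφ heig t hG₁ hG₂ c hrot hsn h₁ h₂ m m
  obtain ⟨z01, e01⟩ := l2_iterIns_doublet β hφ heig t hG₁ hG₂ c hrot hsn h₁ h₂ m (m + 1)
  obtain ⟨-, e11⟩ := l2_iterIns_doublet β hφ heig t hG₁ hG₂ c hrot hsn h₁ h₂ (m + 1) (m + 1)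
  simp only [Function.iterate_succ_apply'] at z01 e01 e11
  exact ⟨z00, e00, e01, z01, e11⟩

/-- **Expansion of the squared residual**: `‖K_βv − a·v‖² = ‖K_βv‖² − 2a⟨v,K_βv⟩ + a²‖v‖²` (physical `v`). [folklore] -/
theorem residual_expand (β : ℝ) {v : GaugeConfig 3 L SU2 → ℝ} (hv : IsPhys v) (a : ℝ) :
    l2 (transferApply β v - a • v) (transferApply β v - a • v) =
      l2 (transferApply β v) (transferApply β v) - 2 * a * l2 v (transferApply β v) + a ^ 2 * l2 v v := by
  set V : physSubmodule L := ⟨v, hv⟩ with hV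
  have hKvv : l2Form L (transferOp β V) V = l2Form L V (transferOp β V) := transferOp_symm β V V
  have h : l2Form L (transferOp β V - a • V) (transferOp β V - a • V) =
      l2Form L (transferOp β V) (transferOp β V) - 2 * a * l2Form L V (transferOp β V) + a ^ 2 * l2Form L V V := by
    simp only [map_sub, map_smul, LinearMap.sub_apply, LinearMap.smul_apply, smul_eq_mul, hKvv]
    ring
  simpa only [l2Form_apply, coe_transferOp, Submodule.coe_sub, Submodule.coe_smul, hV] using h

/-- ★ **The squared residuals of the two rows of a doublet coincide**, for EVERY approximate eigenvalue `a`: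
`‖K_βv₁ − a·v₁‖² = ‖K_βv₂ − a·v₂‖²`. [cite: Luscher1983, §2] [cite: Kato1949, §1] -/
theorem doublet_residual_eq (β : ℝ) {φ : GaugeConfig 3 L SU2 → ℝ} (hφ : IsPhys φ)
    (heig : transferApply β φ = levelValue su2Rep L β 0 • φ) {G₁ G₂ : GaugeConfig 3 1 SU2 → ℝ} (hG₁ : IsPhys G₁) (hG₂ : IsPhys G₂)
    (c : Equiv.Perm (Fin 3)) {cs sn : ℝ} (hrot : cs ^ 2 + sn ^ 2 = 1) (hsn : sn ≠ 0)
    (h₁ : (fun V => G₁ (configPerm c V)) = fun V => cs * G₁ V + sn * G₂ V)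
    (h₂ : (fun V => G₂ (configPerm c V)) = fun V => -sn * G₁ V + cs * G₂ V) (a : ℝ) :
    l2 (transferApply β (dressedLiftVec β φ G₁) - a • dressedLiftVec β φ G₁) (transferApply β (dressedLiftVec β φ G₁) - a • dressedLiftVec β φ G₁) =
      l2 (transferApply β (dressedLiftVec β φ G₂) - a • dressedLiftVec β φ G₂)
        (transferApply β (dressedLiftVec β φ G₂) - a • dressedLiftVec β φ G₂) := by
  obtain ⟨-, enn, ed, -, eKK⟩ := doublet_dressed_numbers β hφ heig hG₁ hG₂ c hrot hsn h₁ h₂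
  rw [residual_expand β (isPhys_dressedLiftVec β hφ hG₁) a, residual_expand β (isPhys_dressedLiftVec β hφ hG₂) a, enn, ed, eKK]

/-- ★★ **(RL) transfers across a doublet with the SAME approximate eigenvalue** (so (CW) holds with width `δ = 0` on doublets): for every `a`, `ρ`,
`‖K_βv₁ − a·v₁‖² ≤ ρ‖v₁‖² ↔ ‖K_βv₂ − a·v₂‖² ≤ ρ‖v₂‖²`. [cite: Luscher1983, §2] [cite: Kato1949, §1] -/
theorem doublet_residualLaw_iff (β : ℝ) {φ : GaugeConfig 3 L SU2 → ℝ} (hφ : IsPhys φ)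
    (heig : transferApply β φ = levelValue su2Rep L β 0 • φ) {G₁ G₂ : GaugeConfig 3 1 SU2 → ℝ} (hG₁ : IsPhys G₁) (hG₂ : IsPhys G₂)
    (c : Equiv.Perm (Fin 3)) {cs sn : ℝ} (hrot : cs ^ 2 + sn ^ 2 = 1) (hsn : sn ≠ 0)
    (h₁ : (fun V => G₁ (configPerm c V)) = fun V => cs * G₁ V + sn * G₂ V)
    (h₂ : (fun V => G₂ (configPerm c V)) = fun V => -sn * G₁ V + cs * G₂ V) (a ρ : ℝ) :
    l2 (transferApply β (dressedLiftVec β φ G₁) - a • dressedLiftVec β φ G₁) (transferApply β (dressedLiftVec β φ G₁) - a • dressedLiftVec β φ G₁) ≤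
        ρ * l2 (dressedLiftVec β φ G₁) (dressedLiftVec β φ G₁) ↔
      l2 (transferApply β (dressedLiftVec β φ G₂) - a • dressedLiftVec β φ G₂) (transferApply β (dressedLiftVec β φ G₂) - a • dressedLiftVec β φ G₂) ≤
        ρ * l2 (dressedLiftVec β φ G₂) (dressedLiftVec β φ G₂) := by
  obtain ⟨-, enn, -, -, -⟩ := doublet_dressed_numbers β hφ heig hG₁ hG₂ c hrot hsn h₁ h₂
  rw [doublet_residual_eq β hφ heig hG₁ hG₂ c hrot hsn h₁ h₂ a, enn]

/-- **Equal Rayleigh quotients on a doublet**: `⟨v₁,K_βv₁⟩/‖v₁‖² = ⟨v₂,K_βv₂⟩/‖v₂‖²` — the natural cluster-constant approximate eigenvalue. [cite: Luscher1983, §2] -/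
theorem doublet_rayleigh_eq (β : ℝ) {φ : GaugeConfig 3 L SU2 → ℝ} (hφ : IsPhys φ)
    (heig : transferApply β φ = levelValue su2Rep L β 0 • φ) {G₁ G₂ : GaugeConfig 3 1 SU2 → ℝ} (hG₁ : IsPhys G₁) (hG₂ : IsPhys G₂)
    (c : Equiv.Perm (Fin 3)) {cs sn : ℝ} (hrot : cs ^ 2 + sn ^ 2 = 1) (hsn : sn ≠ 0)
    (h₁ : (fun V => G₁ (configPerm c V)) = fun V => cs * G₁ V + sn * G₂ V)
    (h₂ : (fun V => G₂ (configPerm c V)) = fun V => -sn * G₁ V + cs * G₂ V) :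
    l2 (dressedLiftVec β φ G₁) (transferApply β (dressedLiftVec β φ G₁)) / l2 (dressedLiftVec β φ G₁) (dressedLiftVec β φ G₁) =
      l2 (dressedLiftVec β φ G₂) (transferApply β (dressedLiftVec β φ G₂)) / l2 (dressedLiftVec β φ G₂) (dressedLiftVec β φ G₂) := by
  obtain ⟨-, enn, ed, -, -⟩ := doublet_dressed_numbers β hφ heig hG₁ hG₂ c hrot hsn h₁ h₂
  rw [enn, ed]

/-- **(GR) on a doublet with any `γ ≥ 0`**: `|⟨v₁,v₂⟩| ≤ γ·√‖v₁‖²·√‖v₂‖²` (the left side is `0`). [cite: Luscher1983, §2] -/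
theorem doublet_gram_le (β : ℝ) {φ : GaugeConfig 3 L SU2 → ℝ} (hφ : IsPhys φ)
    (heig : transferApply β φ = levelValue su2Rep L β 0 • φ) {G₁ G₂ : GaugeConfig 3 1 SU2 → ℝ} (hG₁ : IsPhys G₁) (hG₂ : IsPhys G₂)
    (c : Equiv.Perm (Fin 3)) {cs sn : ℝ} (hrot : cs ^ 2 + sn ^ 2 = 1) (hsn : sn ≠ 0)
    (h₁ : (fun V => G₁ (configPerm c V)) = fun V => cs * G₁ V + sn * G₂ V)
    (h₂ : (fun V => G₂ (configPerm c V)) = fun V => -sn * G₁ V + cs * G₂ V) {γ : ℝ} (hγ : 0 ≤ γ) :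
    |l2 (dressedLiftVec β φ G₁) (dressedLiftVec β φ G₂)| ≤
      γ * (Real.sqrt (l2 (dressedLiftVec β φ G₁) (dressedLiftVec β φ G₁)) * Real.sqrt (l2 (dressedLiftVec β φ G₂) (dressedLiftVec β φ G₂))) := by
  obtain ⟨z, -, -, -, -⟩ := doublet_dressed_numbers β hφ heig hG₁ hG₂ c hrot hsn h₁ h₂
  rw [z, abs_zero]
  exact mul_nonneg hγ (mul_nonneg (Real.sqrt_nonneg _) (Real.sqrt_nonneg _))

/-- The same with the rows exchanged (`|⟨v₂,v₁⟩| ≤ γ·…`). [cite: Luscher1983, §2] -/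
theorem doublet_gram_le' (β : ℝ) {φ : GaugeConfig 3 L SU2 → ℝ} (hφ : IsPhys φ)
    (heig : transferApply β φ = levelValue su2Rep L β 0 • φ) {G₁ G₂ : GaugeConfig 3 1 SU2 → ℝ} (hG₁ : IsPhys G₁) (hG₂ : IsPhys G₂)
    (c : Equiv.Perm (Fin 3)) {cs sn : ℝ} (hrot : cs ^ 2 + sn ^ 2 = 1) (hsn : sn ≠ 0)
    (h₁ : (fun V => G₁ (configPerm c V)) = fun V => cs * G₁ V + sn * G₂ V)
    (h₂ : (fun V => G₂ (configPerm c V)) = fun V => -sn * G₁ V + cs * G₂ V) {γ : ℝ} (hγ : 0 ≤ γ) :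
    |l2 (dressedLiftVec β φ G₂) (dressedLiftVec β φ G₁)| ≤
      γ * (Real.sqrt (l2 (dressedLiftVec β φ G₂) (dressedLiftVec β φ G₂)) * Real.sqrt (l2 (dressedLiftVec β φ G₁) (dressedLiftVec β φ G₁))) := by
  obtain ⟨z, -, -, -, -⟩ := doublet_dressed_numbers β hφ heig hG₁ hG₂ c hrot hsn h₁ h₂
  rw [l2_comm, z, abs_zero]
  exact mul_nonneg hγ (mul_nonneg (Real.sqrt_nonneg _) (Real.sqrt_nonneg _))

/-! ## §2 Cross-type pairs inside an accidentally degenerate one-site level -/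

/-- **(GR) with any `γ ≥ 0` for an invariant `G` against an `H` of vanishing `S₃`-average** (`⟨v_G, v_H⟩ = 0` exactly, infvol-p1's
`l2_dressedLiftVec_eq_zero_of_invariant`). [cite: Luscher1983, §2] -/
theorem gram_le_of_invariant (β : ℝ) {φ : GaugeConfig 3 L SU2 → ℝ} (hφ : IsPhys φ)
    (heig : transferApply β φ = levelValue su2Rep L β 0 • φ) {G H : GaugeConfig 3 1 SU2 → ℝ} (hG : IsPhys G) (hH : IsPhys H)
    (hGinv : ∀ π : Equiv.Perm (Fin 3), (fun V => G (configPerm π V)) = G)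
    (hHavg : ∀ V, ∑ π : Equiv.Perm (Fin 3), H (configPerm π V) = 0) {γ : ℝ} (hγ : 0 ≤ γ) :
    |l2 (dressedLiftVec β φ G) (dressedLiftVec β φ H)| ≤
        γ * (Real.sqrt (l2 (dressedLiftVec β φ G) (dressedLiftVec β φ G)) * Real.sqrt (l2 (dressedLiftVec β φ H) (dressedLiftVec β φ H))) ∧
      |l2 (dressedLiftVec β φ H) (dressedLiftVec β φ G)| ≤
        γ * (Real.sqrt (l2 (dressedLiftVec β φ H) (dressedLiftVec β φ H)) * Real.sqrt (l2 (dressedLiftVec β φ G) (dressedLiftVec β φ G))) := by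
  have z := l2_dressedLiftVec_eq_zero_of_invariant β hφ heig hG hH hGinv hHavg
  refine ⟨?_, ?_⟩
  · rw [z, abs_zero]; exact mul_nonneg hγ (mul_nonneg (Real.sqrt_nonneg _) (Real.sqrt_nonneg _))
  · rw [l2_comm, z, abs_zero]; exact mul_nonneg hγ (mul_nonneg (Real.sqrt_nonneg _) (Real.sqrt_nonneg _))

/-- **(GR) with any `γ ≥ 0` for a sign-type `G` against an `H` of vanishing sign-twisted `S₃`-average** (`⟨v_G, v_H⟩ = 0` exactly, infvol-p1's
`l2_dressedLiftVec_eq_zero_of_sign`). [cite: Luscher1983, §2] -/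
theorem gram_le_of_sign (β : ℝ) {φ : GaugeConfig 3 L SU2 → ℝ} (hφ : IsPhys φ)
    (heig : transferApply β φ = levelValue su2Rep L β 0 • φ) {G H : GaugeConfig 3 1 SU2 → ℝ} (hG : IsPhys G) (hH : IsPhys H)
    (hGsgn : ∀ π : Equiv.Perm (Fin 3), (fun V => G (configPerm π V)) = ((Equiv.Perm.sign π : ℤ) : ℝ) • G)
    (hHavg : ∀ V, ∑ π : Equiv.Perm (Fin 3), ((Equiv.Perm.sign π : ℤ) : ℝ) * H (configPerm π V) = 0) {γ : ℝ} (hγ : 0 ≤ γ) :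
    |l2 (dressedLiftVec β φ G) (dressedLiftVec β φ H)| ≤
        γ * (Real.sqrt (l2 (dressedLiftVec β φ G) (dressedLiftVec β φ G)) * Real.sqrt (l2 (dressedLiftVec β φ H) (dressedLiftVec β φ H))) ∧
      |l2 (dressedLiftVec β φ H) (dressedLiftVec β φ G)| ≤
        γ * (Real.sqrt (l2 (dressedLiftVec β φ H) (dressedLiftVec β φ H)) * Real.sqrt (l2 (dressedLiftVec β φ G) (dressedLiftVec β φ G))) := by
  have z := l2_dressedLiftVec_eq_zero_of_sign β hφ heig hG hH hGsgn hHavg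
  refine ⟨?_, ?_⟩
  · rw [z, abs_zero]; exact mul_nonneg hγ (mul_nonneg (Real.sqrt_nonneg _) (Real.sqrt_nonneg _))
  · rw [l2_comm, z, abs_zero]; exact mul_nonneg hγ (mul_nonneg (Real.sqrt_nonneg _) (Real.sqrt_nonneg _))

/-! ## §3 The (GR) input of the closing press-buttons from «exact symmetry zero ∨ genuine bound» per pair -/

/-- **(GR) for all same-level pairs of a reference family** `v_n = dressedLiftVec β Ω (G n)` (levels `ev n`) from a per-pair alternative: every pair
`n ≠ n'` with `ev n = ev n'` either has `⟨v_n, v_{n'}⟩ = 0` (symmetry-separated or a doublet, §1–§2) or obeys the bound with `γ ≥ 0` — the shape of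
the (GR) hypothesis of `LiftLeak.liftLeakage_dressed_of_referenceLaw` ∕ `residualLaw_allBases_of_reference_lift_width`. [cite: Luscher1983, §2] -/
theorem inLevelGram_of_zero_or_bound (β : ℝ) (Ω : GaugeConfig 3 L SU2 → ℝ) {N : ℕ} (G : Fin N → (GaugeConfig 3 1 SU2 → ℝ))
    (ev : Fin N → ℝ) {γ : ℝ} (hγ : 0 ≤ γ)
    (h : ∀ n n', n ≠ n' → ev n = ev n' →
      l2 (dressedLiftVec β Ω (G n)) (dressedLiftVec β Ω (G n')) = 0 ∨
        |l2 (dressedLiftVec β Ω (G n)) (dressedLiftVec β Ω (G n'))| ≤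
          γ * (Real.sqrt (l2 (dressedLiftVec β Ω (G n)) (dressedLiftVec β Ω (G n))) *
            Real.sqrt (l2 (dressedLiftVec β Ω (G n')) (dressedLiftVec β Ω (G n'))))) :
    ∀ n n', n ≠ n' → ev n = ev n' →
      |l2 (dressedLiftVec β Ω (G n)) (dressedLiftVec β Ω (G n'))| ≤
        γ * (Real.sqrt (l2 (dressedLiftVec β Ω (G n)) (dressedLiftVec β Ω (G n))) *
          Real.sqrt (l2 (dressedLiftVec β Ω (G n')) (dressedLiftVec β Ω (G n')))) := by
  intro n n' hne hev
  rcases h n n' hne hev with hz | hb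
  · rw [hz, abs_zero]; exact mul_nonneg hγ (mul_nonneg (Real.sqrt_nonneg _) (Real.sqrt_nonneg _))
  · exact hb

end Summit.QuantumFields.YangMills.Theorems.FemtoTransferGap.LiftLeak

end
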